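import Summits.Ventures.Crystal3D.Theorems.StickyWulffConstantGenericWallFloorRigidRung
import Summits.Ventures.Crystal3D.Theorems.StickyWulffConstantGenericWallFloorNonSaturation
import HarnessLib

/-!
# The rigid-bicrystal rung of `stub_twoSlabAdhesion`, unconditionally for disjoint non-co-axial pairs

HONEST FRAMING. Part of the venture `Summits/Ventures/Crystal3D` (cell `crystal3d-full`), helper for the
crux `GenericWallFloor` (stmt-Ventures-19480) of `route-Ventures-StickyWulffConstant`, REGISTERED line
`WallLedgerG` (planner cf-p1 gen 16), stub `stub_twoSlabAdhesion` (THE CRUX of the line).  This file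
is the CAPSTONE of the rigid rung: it removes the one local hypothesis of `rigid_twoSlabAdhesion`
(`…GenericWallFloorRigidRung`, this seat) using the kernel non-saturation theorem
`nonsaturation_offCoincidence` (`…GenericWallFloorNonSaturation`, crystal3d-wulff-p2 gen 7; module M5
of the rung, formerly a certified computation).  Rung credit only; F-C1 not moved.

**Theorem (`rigid_twoSlabAdhesion_of_not_coaxial`).**  For every pair of moved fcc lattices which is
NOT co-axial (the stub's hypothesis, verbatim) and whose lattices are DISJOINT (`Λ₁ ∩ Λ₂ = ∅`) there is
`C` (and `R₀ = 3`) such that the conclusion of `TwoSlabAdhesion` holds for every cell of the stub whose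
filling is RIGID (`X ⊆ Λ₁ ∪ Λ₂`) and has CLEAN OUTER SLIVERS (no ball off `Λ₁` below height
`−2R₀ + 1`, none off `Λ₂` above `h + 2R₀ − 1`).

WHAT THIS IS NOT: the stub itself — coincidence sites (exact CSL pairs with `Λ₁ ∩ Λ₂ ≠ ∅`), non-rigid
fillings and the outer slivers are not covered (census note RIGID-RUNG-G2 on the item); rung F-C1 not
moved.
-/

noncomputable section

namespace Summit.Ventures.Crystal3D.Theorems

open Summit.Ventures.Crystal3D Finset
open Literature.MathematicalPhysics.StatisticalMechanics (fccStacking IsHaggSeq barlowStacking contactDeficiency)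
open scoped InnerProductSpace

open scoped Classical in
/-- **The rigid-bicrystal rung of `stub_twoSlabAdhesion`, unconditionally for disjoint non-co-axial
pairs.**  For every NON-co-axial pair of moved fcc lattices with `Λ₁ ∩ Λ₂ = ∅` there is `C` (and
`R₀ = 3`) such that the conclusion of `TwoSlabAdhesion` holds for every cell of the stub whose filling
is RIGID (`X ⊆ Λ₁ ∪ Λ₂`) and has clean outer slivers. -/
theorem rigid_twoSlabAdhesion_of_not_coaxial
    (A₁ : EuclideanSpace ℝ (Fin 3) ≃ₗᵢ[ℝ] EuclideanSpace ℝ (Fin 3)) (t₁ : EuclideanSpace ℝ (Fin 3))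
    (A₂ : EuclideanSpace ℝ (Fin 3) ≃ₗᵢ[ℝ] EuclideanSpace ℝ (Fin 3)) (t₂ : EuclideanSpace ℝ (Fin 3))
    (hnc : ¬ ∃ (L : EuclideanSpace ℝ (Fin 3) ≃ₗᵢ[ℝ] EuclideanSpace ℝ (Fin 3))
        (s₁ s₂ : EuclideanSpace ℝ (Fin 3)) (σ σ' : ℤ → ℤ), IsHaggSeq σ ∧ IsHaggSeq σ' ∧
        (fun p => A₁ p + t₁) '' fccStacking 1 (Real.sqrt (2 / 3)) ⊆
          (fun p => L p + s₁) '' barlowStacking 1 (Real.sqrt (2 / 3)) σ ∧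
        (fun p => A₂ p + t₂) '' fccStacking 1 (Real.sqrt (2 / 3)) ⊆
          (fun p => L p + s₂) '' barlowStacking 1 (Real.sqrt (2 / 3)) σ')
    (hdisj : ∀ p ∈ (fun q => A₁ q + t₁) '' fccStacking 1 (Real.sqrt (2 / 3)),
      p ∉ (fun q => A₂ q + t₂) '' fccStacking 1 (Real.sqrt (2 / 3))) :
    ∃ C R₀ : ℝ, 1 ≤ R₀ ∧ ∀ h : ℝ, 0 ≤ h → ∀ ρ : ℝ, R₀ ≤ ρ →
      ∀ X P₁ P₂ : Finset (EuclideanSpace ℝ (Fin 3)),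
      (∀ p ∈ X, ∀ q ∈ X, p ≠ q → 1 ≤ dist p q) → P₁ ⊆ X → P₂ ⊆ X \ P₁ →
      (∀ p ∈ X, -(2 * R₀) ≤ p 2 ∧ p 2 ≤ h + 2 * R₀ ∧ p 0 ^ 2 + p 1 ^ 2 ≤ ρ ^ 2) →
      (∀ p, p ∈ P₁ ↔ (p ∈ (fun q => A₁ q + t₁) '' fccStacking 1 (Real.sqrt (2 / 3)) ∧
        -(2 * R₀) ≤ p 2 ∧ p 2 ≤ -R₀ ∧ p 0 ^ 2 + p 1 ^ 2 ≤ ρ ^ 2)) →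
      (∀ p, p ∈ P₂ ↔ (p ∈ (fun q => A₂ q + t₂) '' fccStacking 1 (Real.sqrt (2 / 3)) ∧
        h + R₀ ≤ p 2 ∧ p 2 ≤ h + 2 * R₀ ∧ p 0 ^ 2 + p 1 ^ 2 ≤ ρ ^ 2)) →
      -- RIGID filling
      (∀ x ∈ X, x ∈ (fun q => A₁ q + t₁) '' fccStacking 1 (Real.sqrt (2 / 3)) ∨
        x ∈ (fun q => A₂ q + t₂) '' fccStacking 1 (Real.sqrt (2 / 3))) →
      -- CLEAN outer slivers
      (∀ p ∈ X, p 2 < -(2 * R₀) + 1 → p ∈ (fun q => A₁ q + t₁) '' fccStacking 1 (Real.sqrt (2 / 3))) →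
      (∀ p ∈ X, h + 2 * R₀ - 1 < p 2 → p ∈ (fun q => A₂ q + t₂) '' fccStacking 1 (Real.sqrt (2 / 3))) →
      ((((P₁ ×ˢ (X \ P₁)).filter fun pq => dist pq.1 pq.2 = 1).card : ℕ) : ℝ) +
        ((((P₂ ×ˢ ((X \ P₁) \ P₂)).filter fun pq => dist pq.1 pq.2 = 1).card : ℕ) : ℝ) ≤
        contactDeficiency ((X \ P₁) \ P₂) +
          (Real.sqrt 2 / 4 * ∑ᶠ w ∈ {w ∈ fccStacking 1 (Real.sqrt (2 / 3)) | ‖w‖ = 1},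
              |⟪w, A₁.symm (EuclideanSpace.single (2 : Fin 3) (1 : ℝ))⟫_ℝ| +
            Real.sqrt 2 / 4 * ∑ᶠ w ∈ {w ∈ fccStacking 1 (Real.sqrt (2 / 3)) | ‖w‖ = 1},
              |⟪w, A₂.symm (EuclideanSpace.single (2 : Fin 3) (1 : ℝ))⟫_ℝ| - 1) * Real.pi * ρ ^ 2 +
          C * (1 + h) * ρ := by
  classical
  obtain ⟨C, R₀, hR₀, hmain⟩ := rigid_twoSlabAdhesion A₁ t₁ A₂ t₂ hdisj
  refine ⟨C, R₀, hR₀, ?_⟩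
  intro h hh ρ hρ X P₁ P₂ hX hP₁X hP₂X hcell hP₁ hP₂ hrigid hclean₁ hclean₂
  have hnc' : ¬ ∃ (L : EuclideanSpace ℝ (Fin 3) ≃ₗᵢ[ℝ] EuclideanSpace ℝ (Fin 3))
      (s₁ s₂ : EuclideanSpace ℝ (Fin 3)) (σ σ' : ℤ → ℤ), IsHaggSeq σ ∧ IsHaggSeq σ' ∧
      (fun p => A₂ p + t₂) '' fccStacking 1 (Real.sqrt (2 / 3)) ⊆
        (fun p => L p + s₁) '' barlowStacking 1 (Real.sqrt (2 / 3)) σ ∧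
      (fun p => A₁ p + t₁) '' fccStacking 1 (Real.sqrt (2 / 3)) ⊆
        (fun p => L p + s₂) '' barlowStacking 1 (Real.sqrt (2 / 3)) σ' := by
    rintro ⟨L, s₁, s₂, σ, σ', hσ, hσ', h₂, h₁⟩
    exact hnc ⟨L, s₂, s₁, σ', σ, hσ', hσ, h₁, h₂⟩
  refine hmain h hh ρ hρ X P₁ P₂ hX hP₁X hP₂X hcell hP₁ hP₂ hrigid hclean₁ hclean₂ ?_ ?_
  · intro u hu x _ hxΛ hempty _ _
    refine nonsaturation_offCoincidence A₁ A₂ t₁ t₂ x X hnc hxΛ (hdisj x hxΛ) hX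
      (fun q hq _ hq1 => (hrigid q hq).resolve_left hq1) ?_
    exact Finset.card_pos.2 ⟨u, Finset.mem_filter.2 ⟨hu, hempty⟩⟩
  · intro u hu x _ hxΛ hempty _ _
    refine nonsaturation_offCoincidence A₂ A₁ t₂ t₁ x X hnc' hxΛ (fun h1 => hdisj x h1 hxΛ) hX
      (fun q hq _ hq2 => (hrigid q hq).resolve_right hq2) ?_
    exact Finset.card_pos.2 ⟨u, Finset.mem_filter.2 ⟨hu, hempty⟩⟩

end Summit.Ventures.Crystal3D.Theorems

end
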